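import Mathlib.AlgebraicGeometry.Scheme
import HarnessLib

/-!
# Čech `1`-cocycles of units on point-indexed covers and the group of their classes

For a scheme `X` (the constructions only use the ringed space) we set up the target of the
cocycle-valued determinant `K₀(X) → Ȟ¹(X, 𝒪_X^×)` of `Modules/DeterminantCocycle.lean`:

* `UnitCocycle X` — a Čech `1`-cocycle of units of `𝒪_X` on an open cover INDEXED BY THE POINTS of
  `X` (`x ↦ U_x ∋ x`): sections `g_{xy} ∈ Γ(X, V)` for every open `V ≤ U_x ⊓ U_y`, compatible with
  restriction, with `g_{xy} g_{yz} = g_{xz}` and `g_{xx} = 1` (hence units, `isUnit_g`). Indexing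
  covers by points makes common refinements trivial (`U_x ⊓ U'_x`), and carrying `g_{xy}` on every
  `V` below `U_x ⊓ U_y` (rather than on `U_x ⊓ U_y` only) removes all explicit restriction maps from
  products (Hartshorne III §4, Čech cocycles; Ex. III.4.4 for refinements).
* `UnitCocycle.Coboundary c c'` / `UnitCocycle.Equiv` — `c'` and `c` differ by a coboundary
  `(λ_x)` on a common point-indexed refinement: `g'_{xy} λ_y = λ_x g_{xy}`; an equivalence relation.
* `CechPic X` — the quotient, an abelian group under pointwise product (`CommGroup`); it is the
  Čech cohomology group `Ȟ¹(X, 𝒪_X^×)` computed on point-indexed covers, which classifies line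
  bundles (Hartshorne III Ex. 4.5: `Pic X ≅ Ȟ¹(X, 𝒪_X^×)`; the comparison with line bundles is
  `Modules/LineBundleCocycle.lean`).
* the pull-back `CechPic.pullback f : CechPic Y →* CechPic X` along a morphism of schemes is in
  `Modules/UnitCocyclePullback.lean`.

Everything is proved; no named facts. Deliberately not here: Čech cohomology in other degrees,
comparison with derived-functor cohomology.

## References

* R. Hartshorne, *Algebraic Geometry*, GTM 52 (1977), III §4 and Ex. III.4.4, III.4.5.
  [Hartshorne1977]
-/

noncomputable section

open CategoryTheory AlgebraicGeometry Opposite TopologicalSpace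

namespace Literature.AlgebraicGeometry.Modules

universe u

variable {X Y Z : Scheme.{u}}

/-- Restriction of sections of the structure sheaf along `V' ≤ V`, as a ring homomorphism
(a notation-free abbreviation for `X.presheaf.map (homOfLE i).op`). [folklore] -/
abbrev secRes (X : Scheme.{u}) {V V' : X.Opens} (i : V' ≤ V) : Γ(X, V) →+* Γ(X, V') :=
  (X.presheaf.map (homOfLE i).op).hom

/-- `secRes` along `V ≤ V` is the identity. [folklore] -/
@[simp]
lemma secRes_self {V : X.Opens} (a : Γ(X, V)) : secRes X (le_refl V) a = a := by
  change (X.presheaf.map (𝟙 V).op) a = a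
  rw [op_id, X.presheaf.map_id]
  rfl

/-- `secRes` is transitive. [folklore] -/
lemma secRes_secRes {V V' V'' : X.Opens} (i : V' ≤ V) (j : V'' ≤ V') (a : Γ(X, V)) :
    secRes X j (secRes X i a) = secRes X (j.trans i) a := by
  change (X.presheaf.map (homOfLE i).op ≫ X.presheaf.map (homOfLE j).op) a = _
  rw [← X.presheaf.map_comp]
  rfl

variable (X) in
/-- **A Čech `1`-cocycle of units of `𝒪_X` on a point-indexed open cover**: opens `U_x ∋ x` and
sections `g_{xy} ∈ Γ(X, V)` for all opens `V ≤ U_x ⊓ U_y`, compatible with restriction, satisfying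
the cocycle condition `g_{xy} g_{yz} = g_{xz}` and `g_{xx} = 1` (Hartshorne III §4). [folklore] -/
structure UnitCocycle where
  /-- The open neighbourhood `U_x` of the point `x`. -/
  U : X → X.Opens
  /-- `x ∈ U_x`. -/
  mem : ∀ x, x ∈ U x
  /-- The transition function `g_{xy}` over an open `V ≤ U_x ⊓ U_y`. -/
  g : ∀ (x y : X) (V : X.Opens), V ≤ U x → V ≤ U y → Γ(X, V)
  /-- Compatibility with restriction. -/
  map_g : ∀ (x y : X) {V V' : X.Opens} (hx : V ≤ U x) (hy : V ≤ U y) (i : V' ≤ V),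
    secRes X i (g x y V hx hy) = g x y V' (i.trans hx) (i.trans hy)
  /-- The cocycle condition `g_{xy} g_{yz} = g_{xz}`. -/
  g_mul : ∀ (x y z : X) (V : X.Opens) (hx : V ≤ U x) (hy : V ≤ U y) (hz : V ≤ U z),
    g x y V hx hy * g y z V hy hz = g x z V hx hz
  /-- `g_{xx} = 1`. -/
  g_self : ∀ (x : X) (V : X.Opens) (hx : V ≤ U x), g x x V hx hx = 1

namespace UnitCocycle

variable (c c' c'' : UnitCocycle X)

/-- `g_{xy} g_{yx} = 1`. [folklore] -/
lemma g_mul_symm (x y : X) (V : X.Opens) (hx : V ≤ c.U x) (hy : V ≤ c.U y) :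
    c.g x y V hx hy * c.g y x V hy hx = 1 := by
  rw [c.g_mul, c.g_self]

/-- The transition functions are units. [folklore] -/
lemma isUnit_g (x y : X) (V : X.Opens) (hx : V ≤ c.U x) (hy : V ≤ c.U y) :
    IsUnit (c.g x y V hx hy) :=
  IsUnit.of_mul_eq_one _ (c.g_mul_symm x y V hx hy)

/-! ### Coboundaries and the equivalence relation -/

/-- **A coboundary between two cocycles**: a point-indexed common refinement `W_x ≤ U_x ⊓ U'_x` and
invertible sections `λ_x` over the opens below `W_x` (with chosen inverses), compatible with
restriction, such that `g'_{xy} λ_y = λ_x g_{xy}` (Hartshorne III §4: the two cocycles define the same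
class in `Ȟ¹`). [folklore] -/
structure Coboundary (c c' : UnitCocycle X) where
  /-- The refining neighbourhood `W_x` of `x`. -/
  W : X → X.Opens
  /-- `x ∈ W_x`. -/
  mem : ∀ x, x ∈ W x
  /-- `W_x ≤ U_x`. -/
  le : ∀ x, W x ≤ c.U x
  /-- `W_x ≤ U'_x`. -/
  le' : ∀ x, W x ≤ c'.U x
  /-- The `0`-cochain `λ_x` over an open `V ≤ W_x`. -/
  lam : ∀ (x : X) (V : X.Opens), V ≤ W x → Γ(X, V)
  /-- A chosen inverse of `λ_x`. -/
  inv : ∀ (x : X) (V : X.Opens), V ≤ W x → Γ(X, V)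
  /-- Compatibility of `λ` with restriction. -/
  map_lam : ∀ (x : X) {V V' : X.Opens} (h : V ≤ W x) (i : V' ≤ V),
    secRes X i (lam x V h) = lam x V' (i.trans h)
  /-- `λ_x λ_x⁻¹ = 1`. -/
  lam_mul_inv : ∀ (x : X) (V : X.Opens) (h : V ≤ W x), lam x V h * inv x V h = 1
  /-- The coboundary relation `g'_{xy} λ_y = λ_x g_{xy}`. -/
  rel : ∀ (x y : X) (V : X.Opens) (hx : V ≤ W x) (hy : V ≤ W y),
    c'.g x y V (hx.trans (le' x)) (hy.trans (le' y)) * lam y V hy =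
      lam x V hx * c.g x y V (hx.trans (le x)) (hy.trans (le y))

namespace Coboundary

variable {c c' c''}

/-- The chosen inverses are compatible with restriction (uniqueness of inverses). [folklore] -/
lemma map_inv (b : Coboundary c c') (x : X) {V V' : X.Opens} (h : V ≤ b.W x) (i : V' ≤ V) :
    secRes X i (b.inv x V h) = b.inv x V' (i.trans h) := by
  have h₁ : b.lam x V' (i.trans h) * secRes X i (b.inv x V h) = 1 := by
    rw [← b.map_lam x h i, ← map_mul, b.lam_mul_inv, map_one]
  have h₂ := b.lam_mul_inv x V' (i.trans h)
  calc secRes X i (b.inv x V h)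
      = secRes X i (b.inv x V h) * (b.lam x V' (i.trans h) * b.inv x V' (i.trans h)) := by
        rw [h₂, mul_one]
    _ = b.lam x V' (i.trans h) * secRes X i (b.inv x V h) * b.inv x V' (i.trans h) := by ring
    _ = b.inv x V' (i.trans h) := by rw [h₁, one_mul]

/-- The coboundary relation for the inverses: `g_{xy} λ_y⁻¹ = λ_x⁻¹ g'_{xy}`. [folklore] -/
lemma rel_inv (b : Coboundary c c') (x y : X) (V : X.Opens) (hx : V ≤ b.W x) (hy : V ≤ b.W y) :
    c.g x y V (hx.trans (b.le x)) (hy.trans (b.le y)) * b.inv y V hy =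
      b.inv x V hx * c'.g x y V (hx.trans (b.le' x)) (hy.trans (b.le' y)) := by
  have h := b.rel x y V hx hy
  have hx1 := b.lam_mul_inv x V hx
  have hy1 := b.lam_mul_inv y V hy
  calc c.g x y V _ _ * b.inv y V hy
      = b.inv x V hx * (b.lam x V hx * c.g x y V _ _) * b.inv y V hy := by
        rw [← mul_assoc, mul_comm (b.inv x V hx), hx1, one_mul]
    _ = b.inv x V hx * (c'.g x y V _ _ * b.lam y V hy) * b.inv y V hy := by rw [h]
    _ = b.inv x V hx * c'.g x y V _ _ * (b.lam y V hy * b.inv y V hy) := by ring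
    _ = b.inv x V hx * c'.g x y V _ _ := by rw [hy1, mul_one]

variable (c) in
/-- The trivial coboundary from a cocycle to itself. [folklore] -/
def refl : Coboundary c c where
  W := c.U
  mem := c.mem
  le _ := le_rfl
  le' _ := le_rfl
  lam _ _ _ := 1
  inv _ _ _ := 1
  map_lam _ _ _ _ _ := map_one _
  lam_mul_inv _ _ _ := mul_one 1
  rel _ _ _ _ _ := by rw [mul_one, one_mul]

/-- Coboundaries can be reversed. [folklore] -/
def symm (b : Coboundary c c') : Coboundary c' c where
  W := b.W
  mem := b.mem
  le := b.le'
  le' := b.le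
  lam := b.inv
  inv := b.lam
  map_lam x _ _ h i := b.map_inv x h i
  lam_mul_inv x V h := by rw [mul_comm, b.lam_mul_inv]
  rel x y V hx hy := b.rel_inv x y V hx hy

/-- Coboundaries compose (on the intersection of the refinements). [folklore] -/
def trans (b : Coboundary c c') (b' : Coboundary c' c'') : Coboundary c c'' where
  W x := b.W x ⊓ b'.W x
  mem x := ⟨b.mem x, b'.mem x⟩
  le x := inf_le_left.trans (b.le x)
  le' x := inf_le_right.trans (b'.le' x)
  lam x V h := b'.lam x V (h.trans inf_le_right) * b.lam x V (h.trans inf_le_left)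
  inv x V h := b.inv x V (h.trans inf_le_left) * b'.inv x V (h.trans inf_le_right)
  map_lam x _ _ h i := by rw [map_mul, b.map_lam, b'.map_lam]
  lam_mul_inv x V h := by
    calc b'.lam x V _ * b.lam x V _ * (b.inv x V _ * b'.inv x V _)
        = b'.lam x V _ * (b.lam x V _ * b.inv x V _) * b'.inv x V _ := by ring
      _ = 1 := by rw [b.lam_mul_inv, mul_one, b'.lam_mul_inv]
  rel x y V hx hy := by
    have h₁ := b.rel x y V (hx.trans inf_le_left) (hy.trans inf_le_left)
    have h₂ := b'.rel x y V (hx.trans inf_le_right) (hy.trans inf_le_right)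
    calc c''.g x y V _ _ * (b'.lam y V _ * b.lam y V _)
        = c''.g x y V _ _ * b'.lam y V _ * b.lam y V _ := by rw [mul_assoc]
      _ = b'.lam x V _ * c'.g x y V _ _ * b.lam y V _ := by rw [h₂]
      _ = b'.lam x V _ * (c'.g x y V _ _ * b.lam y V _) := by rw [mul_assoc]
      _ = b'.lam x V _ * (b.lam x V _ * c.g x y V _ _) := by rw [h₁]
      _ = b'.lam x V _ * b.lam x V _ * c.g x y V _ _ := by rw [mul_assoc]

end Coboundary

/-- Two cocycles are **equivalent** (cohomologous) if they differ by a coboundary on a common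
point-indexed refinement. [folklore] -/
def Equiv (c c' : UnitCocycle X) : Prop :=
  Nonempty (Coboundary c c')

/-- Cohomology of cocycles is an equivalence relation. [folklore] -/
lemma Equiv.isEquivalence : Equivalence (Equiv (X := X)) where
  refl c := ⟨Coboundary.refl c⟩
  symm := fun ⟨b⟩ => ⟨b.symm⟩
  trans := fun ⟨b⟩ ⟨b'⟩ => ⟨b.trans b'⟩

variable (X) in
/-- The setoid of cocycles modulo coboundaries. [folklore] -/
def setoid : Setoid (UnitCocycle X) where
  r := Equiv
  iseqv := Equiv.isEquivalence

/-! ### Product, unit and inverse of cocycles -/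

/-- The product of two cocycles (on the intersections `U_x ⊓ U'_x`). [folklore] -/
def mul (c c' : UnitCocycle X) : UnitCocycle X where
  U x := c.U x ⊓ c'.U x
  mem x := ⟨c.mem x, c'.mem x⟩
  g x y V hx hy := c.g x y V (hx.trans inf_le_left) (hy.trans inf_le_left) *
    c'.g x y V (hx.trans inf_le_right) (hy.trans inf_le_right)
  map_g x y _ _ hx hy i := by rw [map_mul, c.map_g, c'.map_g]
  g_mul x y z V hx hy hz := by
    rw [mul_mul_mul_comm, c.g_mul, c'.g_mul]
  g_self x V hx := by rw [c.g_self, c'.g_self, mul_one]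

variable (X) in
/-- The trivial cocycle `g = 1` (on `U_x = X`). [folklore] -/
def one : UnitCocycle X where
  U _ := ⊤
  mem _ := trivial
  g _ _ _ _ _ := 1
  map_g _ _ _ _ _ _ _ := map_one _
  g_mul _ _ _ _ _ _ _ := mul_one 1
  g_self _ _ _ := rfl

/-- The inverse cocycle `(x, y) ↦ g_{yx}`. [folklore] -/
def inv (c : UnitCocycle X) : UnitCocycle X where
  U := c.U
  mem := c.mem
  g x y V hx hy := c.g y x V hy hx
  map_g x y _ _ hx hy i := c.map_g y x hy hx i
  g_mul x y z V hx hy hz := by rw [mul_comm, c.g_mul]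
  g_self x V hx := c.g_self x V hx

/-- The product of cocycles is compatible with equivalence. [folklore] -/
lemma mul_equiv {c₁ c₁' c₂ c₂' : UnitCocycle X} (h₁ : Equiv c₁ c₁') (h₂ : Equiv c₂ c₂') :
    Equiv (mul c₁ c₂) (mul c₁' c₂') := by
  obtain ⟨b₁⟩ := h₁
  obtain ⟨b₂⟩ := h₂
  exact ⟨{
    W := fun x => b₁.W x ⊓ b₂.W x
    mem := fun x => ⟨b₁.mem x, b₂.mem x⟩
    le := fun x => inf_le_inf (b₁.le x) (b₂.le x)
    le' := fun x => inf_le_inf (b₁.le' x) (b₂.le' x)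
    lam := fun x V h => b₁.lam x V (h.trans inf_le_left) * b₂.lam x V (h.trans inf_le_right)
    inv := fun x V h => b₁.inv x V (h.trans inf_le_left) * b₂.inv x V (h.trans inf_le_right)
    map_lam := fun x _ _ h i => by rw [map_mul, b₁.map_lam, b₂.map_lam]
    lam_mul_inv := fun x V h => by
      rw [mul_mul_mul_comm, b₁.lam_mul_inv, b₂.lam_mul_inv, mul_one]
    rel := fun x y V hx hy => by
      have r₁ := b₁.rel x y V (hx.trans inf_le_left) (hy.trans inf_le_left)
      have r₂ := b₂.rel x y V (hx.trans inf_le_right) (hy.trans inf_le_right)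
      change c₁'.g x y V _ _ * c₂'.g x y V _ _ * _ = _ * (c₁.g x y V _ _ * c₂.g x y V _ _)
      rw [mul_mul_mul_comm, r₁, r₂, mul_mul_mul_comm] }⟩

/-- The inverse of cocycles is compatible with equivalence. [folklore] -/
lemma inv_equiv {c c' : UnitCocycle X} (h : Equiv c c') : Equiv (inv c) (inv c') := by
  obtain ⟨b⟩ := h
  exact ⟨{
    W := b.W
    mem := b.mem
    le := b.le
    le' := b.le'
    lam := b.inv
    inv := b.lam
    map_lam := fun x _ _ h i => b.map_inv x h i
    lam_mul_inv := fun x V h => by rw [mul_comm, b.lam_mul_inv]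
    rel := fun x y V hx hy => by
      change c'.g y x V _ _ * b.inv y V hy = b.inv x V hx * c.g y x V _ _
      have r := b.rel_inv y x V hy hx
      linear_combination -r }⟩

/-- A cocycle is equivalent to any cocycle with the same transition functions on a point-indexed
refinement. [folklore] -/
lemma equiv_of_eq (c c' : UnitCocycle X) (W : X → X.Opens) (mem : ∀ x, x ∈ W x)
    (le : ∀ x, W x ≤ c.U x) (le' : ∀ x, W x ≤ c'.U x)
    (h : ∀ (x y : X) (V : X.Opens) (hx : V ≤ W x) (hy : V ≤ W y),
      c'.g x y V (hx.trans (le' x)) (hy.trans (le' y)) =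
        c.g x y V (hx.trans (le x)) (hy.trans (le y))) : Equiv c c' :=
  ⟨{ W := W
     mem := mem
     le := le
     le' := le'
     lam := fun _ _ _ => 1
     inv := fun _ _ _ => 1
     map_lam := fun _ _ _ _ _ => map_one _
     lam_mul_inv := fun _ _ _ => mul_one 1
     rel := fun x y V hx hy => by rw [mul_one, one_mul, h x y V hx hy] }⟩

end UnitCocycle

/-! ### The group of cocycle classes -/

variable (X) in
/-- **The Čech Picard group** `Ȟ¹(X, 𝒪_X^×)` of a scheme, computed with cocycles on point-indexed
open covers modulo coboundaries; it classifies line bundles on `X` (Hartshorne III Ex. 4.5,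
`Pic X ≅ Ȟ¹(X, 𝒪_X^×)`). [cite: Hartshorne1977, III Ex. 4.5] -/
def CechPic : Type u :=
  Quotient (UnitCocycle.setoid X)

namespace CechPic

/-- The class of a cocycle. [folklore] -/
def mk (c : UnitCocycle X) : CechPic X :=
  Quotient.mk (UnitCocycle.setoid X) c

/-- Every class is the class of a cocycle. [folklore] -/
lemma mk_surjective : Function.Surjective (mk (X := X)) :=
  Quotient.mk_surjective

/-- Two cocycles have the same class iff they are cohomologous. [folklore] -/
lemma mk_eq_mk_iff (c c' : UnitCocycle X) : mk c = mk c' ↔ UnitCocycle.Equiv c c' :=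
  Quotient.eq (r := UnitCocycle.setoid X)

/-- Cohomologous cocycles have the same class. [folklore] -/
lemma sound {c c' : UnitCocycle X} (h : UnitCocycle.Equiv c c') : mk c = mk c' :=
  (mk_eq_mk_iff c c').2 h

/-- **`Ȟ¹(X, 𝒪_X^×)` is an abelian group** under the product of cocycles. [folklore] -/
instance instCommGroup : CommGroup (CechPic X) where
  mul := Quotient.map₂ UnitCocycle.mul (fun _ _ h₁ _ _ h₂ => by exact UnitCocycle.mul_equiv h₁ h₂)
  one := mk (UnitCocycle.one X)
  inv := Quotient.map UnitCocycle.inv (fun _ _ h => by exact UnitCocycle.inv_equiv h)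
  mul_assoc := by
    rintro ⟨a⟩ ⟨b⟩ ⟨c⟩
    refine Quotient.sound (UnitCocycle.equiv_of_eq _ _ (fun x => a.U x ⊓ b.U x ⊓ c.U x)
      (fun x => ⟨⟨a.mem x, b.mem x⟩, c.mem x⟩) (fun x => le_rfl)
      (fun x => (inf_assoc (a.U x) (b.U x) (c.U x)).le) ?_)
    intro x y V hx hy
    exact (mul_assoc _ _ _).symm
  one_mul := by
    rintro ⟨a⟩
    refine Quotient.sound (UnitCocycle.equiv_of_eq _ _ a.U a.mem (fun x => le_inf le_top le_rfl)
      (fun x => le_rfl) ?_)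
    intro x y V hx hy
    exact (one_mul _).symm
  mul_one := by
    rintro ⟨a⟩
    refine Quotient.sound (UnitCocycle.equiv_of_eq _ _ a.U a.mem (fun x => le_inf le_rfl le_top)
      (fun x => le_rfl) ?_)
    intro x y V hx hy
    exact (mul_one _).symm
  mul_comm := by
    rintro ⟨a⟩ ⟨b⟩
    refine Quotient.sound (UnitCocycle.equiv_of_eq _ _ (fun x => a.U x ⊓ b.U x)
      (fun x => ⟨a.mem x, b.mem x⟩) (fun x => le_rfl) (fun x => (inf_comm (a.U x) (b.U x)).le) ?_)
    intro x y V hx hy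
    exact mul_comm _ _
  inv_mul_cancel := by
    rintro ⟨a⟩
    refine Quotient.sound (UnitCocycle.equiv_of_eq _ _ a.U a.mem (fun x => le_inf le_rfl le_rfl)
      (fun x => le_top) ?_)
    intro x y V hx hy
    exact (a.g_mul_symm y x V _ _).symm

/-- The class of a product of cocycles is the product of the classes. [folklore] -/
lemma mk_mul (c c' : UnitCocycle X) : mk (UnitCocycle.mul c c') = mk c * mk c' := rfl

/-- The class of the trivial cocycle is `1`. [folklore] -/
lemma mk_one : mk (UnitCocycle.one X) = 1 := rfl

/-- The class of the inverse cocycle is the inverse class. [folklore] -/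
lemma mk_inv (c : UnitCocycle X) : mk (UnitCocycle.inv c) = (mk c)⁻¹ := rfl

end CechPic

end Literature.AlgebraicGeometry.Modules

end
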